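import Summits.ResolutionOfSingularities.ResolutionOfSingularities.Theorems.WildQuotientsSummitReductionStubPairQuasiSplitBaseChangeLevels
import Literature.AlgebraicGeometry.Resolution.AlterationsSemiStableCodimTwoBlowupReduction
import Literature.AlgebraicGeometry.Resolution.SmoothFibreChart
import Literature.AlgebraicGeometry.Resolution.AdicQuotient
import HarnessLib

/-!
# `WildQuotients.SummitReduction` (stmt-ResolutionOfSingularities-16324), line `FramePerfect`:
# the completed FIBRE local ring of the blown-up curve at a chart origin is the formal node
# `κ(y)⟦u, v⟧/(uv)` (algebra of stub `stub_pair_orbitBlowupCentreLocal`)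

Route `ResolutionOfSingularities/WildQuotients`, crux `SummitReduction`; helper file of stub
`stub_pair_orbitBlowupCentreLocal` (C2: de Jong 1996, 3.4 Claim (ii) over the orbit centre, with
quasi-splitness upstairs — de Jong 1997, proof of Prop. 5.11 ¶1: "the singular points of the fibres
of `X' → Y` in `E` are rational with rational tangents"). Files 1–3 identify the completed local ring
`𝒪̂_{X₁,x'}` at a point over the centre with the completion of a chart ring
`R = Λ[U, T']/(UT' - t)` (or `Λ[V, T']/(VT' - t)`, `Λ[U', V']/(U'V' - c)`) at a prime `𝔔 ⊇ 𝔪_Λ R`,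
compatibly with `𝒪_{Y,y} → 𝒪_{X₁,x'}` resp. `𝒪_{Y,y} → Λ → R_𝔔` (`Λ = 𝒪̂_{Y,y}` in Cohen coordinates).
This file is the pure algebra turning that into the quasi-split rendering of the line at `x'`
("For the convenience of the reader we give the special fibre intersected with this chart; it is
the spectrum of the ring `k[u, t₁']/(ut₁')`", de Jong 1996, p. 64):

* `exists_fibreCpl_equiv_of_localCpl_equiv` — an isomorphism of completed local rings `𝒪̂' ≅ T̂`
  compatible with ring maps `ψ : A → 𝒪'`, `θ : A → T` induces an isomorphism of the completed
  FIBRE rings `(𝒪'/𝔪_A 𝒪')^ ≅ (T/𝔪_A T)^` compatible with `A` (completion commutes with quotients,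
  Matsumura 8.11);
* `exists_fibreCpl_equiv_nodeQuot_of_chart` — **if moreover `T = R_𝔔` for a chart ring
  `R = Λ[x, y]/(xy - a₀)` with `θ = (Λ → R_𝔔) ∘ β`, where `β : A → Λ` is residually onto with
  `𝔪_A Λ = 𝔪_Λ`, and the prime `𝔔 ⊇ 𝔪_Λ R` contains `x̄` and `ȳ` (the ORIGIN of the special fibre
  `κ[x, y]/(xy)`), then `(𝒪'/𝔪_A 𝒪')^ ≅ κ(A)⟦u, v⟧/(uv)` compatibly with `κ(A)`** — the quasi-split
  datum at `x'`: `T/𝔪_A T = (R/𝔪_Λ R)_𝔔 = (κ[x, y]/(xy))_{(x,y)}`, whose completion is `κ⟦x, y⟧/(xy)`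
  (`exists_completion_algebraicNodeRing_equiv`), and `κ = Λ/𝔪_Λ ≅ A/𝔪_A` along `β`.
-/

set_option linter.dupNamespace false

noncomputable section

open IsLocalRing AdicCompletion
open Literature.AlgebraicGeometry.Resolution

namespace Summit.ResolutionOfSingularities.ResolutionOfSingularities.Theorems

universe u

/-! ## Completed fibre rings from completed local rings -/

section FibreCompletion

variable {A O' T : Type u} [CommRing A] [IsLocalRing A] [CommRing O'] [IsLocalRing O']
  [IsNoetherianRing O'] [CommRing T] [IsLocalRing T] [IsNoetherianRing T]

/-- **An isomorphism of completed local rings over `A` induces an isomorphism of the completed fibre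
rings over `A`**: if `E : 𝒪̂' ≅ T̂` satisfies `E(ψ a) = θ a`, then
`(𝒪'/𝔪_A 𝒪')^ ≅ 𝒪̂'/𝔪_A 𝒪̂' ≅ T̂/𝔪_A T̂ ≅ (T/𝔪_A T)^` (Matsumura 8.11, `quotientCompletionEquiv`),
compatibly with `A`. [cite: Matsumura1987, Thm. 8.11] -/
theorem exists_fibreCpl_equiv_of_localCpl_equiv (ψ : A →+* O') (θ : A →+* T)
    (E : LocalCpl O' ≃+* LocalCpl T)
    (hE : ∀ a, E (AdicCompletion.of _ _ (ψ a)) = AdicCompletion.of _ _ (θ a)) :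
    ∃ E' : AdicCompletion ((maximalIdeal O').map (Ideal.Quotient.mk ((maximalIdeal A).map ψ)))
          (O' ⧸ (maximalIdeal A).map ψ) ≃+*
        AdicCompletion ((maximalIdeal T).map (Ideal.Quotient.mk ((maximalIdeal A).map θ)))
          (T ⧸ (maximalIdeal A).map θ),
      ∀ a, E' (AdicCompletion.of _ _ (Ideal.Quotient.mk _ (ψ a))) =
        AdicCompletion.of _ _ (Ideal.Quotient.mk _ (θ a)) := by
  set J₁ : Ideal O' := (maximalIdeal A).map ψ with hJ₁
  set J₂ : Ideal T := (maximalIdeal A).map θ with hJ₂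
  -- the extended ideals in the completions correspond under `E`
  have hJ : J₂.map (algebraMap T (LocalCpl T)) = (J₁.map (algebraMap O' (LocalCpl O'))).map E.toRingHom := by
    rw [hJ₁, hJ₂, Ideal.map_map, Ideal.map_map, Ideal.map_map]
    congr 1
    refine RingHom.ext fun a => ?_
    simp only [RingHom.comp_apply, RingEquiv.toRingHom_eq_coe, RingHom.coe_coe]
    exact (hE a).symm
  let q₁ := quotientCompletionEquiv (localMaxIdeal O') J₁
  let q₂ := quotientCompletionEquiv (localMaxIdeal T) J₂
  let qE := Ideal.quotientEquiv (J₁.map (algebraMap O' (LocalCpl O'))) (J₂.map (algebraMap T (LocalCpl T)))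
    E hJ
  refine ⟨q₁.symm.trans (qE.trans q₂), fun a => ?_⟩
  have h1 : q₁.symm (AdicCompletion.of _ _ (Ideal.Quotient.mk _ (ψ a))) =
      Ideal.Quotient.mk _ (AdicCompletion.of _ _ (ψ a)) :=
    (RingEquiv.symm_apply_eq q₁).mpr (quotientCompletionEquiv_mk_of (localMaxIdeal O') J₁ (ψ a)).symm
  rw [RingEquiv.trans_apply, RingEquiv.trans_apply, h1]
  change q₂ (qE (Ideal.Quotient.mk _ (AdicCompletion.of _ _ (ψ a)))) = _
  rw [Ideal.quotientEquiv_mk]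
  erw [hE a]
  exact quotientCompletionEquiv_mk_of (localMaxIdeal T) J₂ (θ a)

end FibreCompletion

/-! ## The chart origin: `(R/𝔪_Λ R)_𝔔 = (κ[x, y]/(xy))_{(x,y)}` and its completion -/

section ChartOrigin

open DeJong1996 DeJong1996.AlgebraicNodeRing

variable {Λ : Type u} [CommRing Λ] [IsLocalRing Λ] {a₀ : Λ}
  (𝔔 : Ideal (AlgebraicNodeRing Λ a₀)) [𝔔.IsPrime]
  (h𝔔Λ : (maximalIdeal Λ).map (algebraMap Λ (AlgebraicNodeRing Λ a₀)) ≤ 𝔔)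
  (hu : u Λ a₀ ∈ 𝔔) (hv : v Λ a₀ ∈ 𝔔)

include h𝔔Λ hv in
/-- At a prime of the chart ring over `𝔪_Λ` containing `ȳ`, the parameter `a₀` lies in `𝔪_Λ`
(`x̄ȳ = a₀`). [folklore] -/
theorem mem_maximalIdeal_of_v_mem : a₀ ∈ maximalIdeal Λ := by
  have h1 : algebraMap Λ (AlgebraicNodeRing Λ a₀) a₀ ∈ 𝔔 := by
    rw [← u_mul_v]
    exact Ideal.mul_mem_left _ _ hv
  have h2 : (𝔔.comap (algebraMap Λ (AlgebraicNodeRing Λ a₀))) ≠ ⊤ := by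
    rw [Ne, Ideal.comap_eq_top_iff]
    exact Ideal.IsPrime.ne_top inferInstance
  have h3 : maximalIdeal Λ ≤ 𝔔.comap (algebraMap Λ (AlgebraicNodeRing Λ a₀)) := by
    rw [← Ideal.map_le_iff_le_comap]
    exact h𝔔Λ
  have h4 := (IsLocalRing.maximalIdeal.isMaximal Λ).eq_of_le h2 h3
  rw [h4]
  exact h1

include h𝔔Λ hu hv in
/-- **The image of `𝔔` in `R/𝔪_Λ R ≅ κ[x, y]/(xy)` is the origin `(x̄, ȳ)`** (it contains `x̄, ȳ` and
the origin is maximal), along `quotientEquiv` and `congrRight`. [folklore] -/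
theorem map_quotient_eq_nodeOrigin
    (h0 : Ideal.Quotient.mk (maximalIdeal Λ) a₀ = 0) :
    ((𝔔.map (Ideal.Quotient.mk ((maximalIdeal Λ).map (algebraMap Λ (AlgebraicNodeRing Λ a₀))))).map
      ((quotientEquiv Λ a₀ (maximalIdeal Λ)).trans
        (congrRight (ResidueField Λ) h0).toRingEquiv).toRingHom) = nodeOrigin (ResidueField Λ) := by
  set e := (quotientEquiv Λ a₀ (maximalIdeal Λ)).trans (congrRight (ResidueField Λ) h0).toRingEquiv with he
  set 𝔔bar := 𝔔.map (Ideal.Quotient.mk ((maximalIdeal Λ).map (algebraMap Λ (AlgebraicNodeRing Λ a₀))))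
  haveI : 𝔔bar.IsPrime := isPrime_map_quotient_mk 𝔔 h𝔔Λ
  haveI hprime : (𝔔bar.map e.toRingHom).IsPrime := Ideal.map_isPrime_of_equiv e
  -- `nodeOrigin = (x̄, ȳ)`
  have hspan : nodeOrigin (ResidueField Λ) = Ideal.span {u (ResidueField Λ) 0, v (ResidueField Λ) 0} := by
    rw [nodeOrigin, originIdeal_eq_span, Ideal.map_span, ← Set.range_comp]
    congr 1
    ext z
    simp only [Set.mem_range, Function.comp_apply, Set.mem_insert_iff, Set.mem_singleton_iff]
    constructor
    · rintro ⟨i, rfl⟩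
      fin_cases i
      · exact Or.inl rfl
      · exact Or.inr rfl
    · rintro (rfl | rfl)
      · exact ⟨0, rfl⟩
      · exact ⟨1, rfl⟩
  symm
  refine (nodeOrigin_isMaximal (ResidueField Λ)).eq_of_le hprime.ne_top ?_
  rw [hspan, Ideal.span_le]
  have hu' : u (ResidueField Λ) 0 ∈ 𝔔bar.map e.toRingHom := by
    have : e (Ideal.Quotient.mk _ (u Λ a₀)) = u (ResidueField Λ) 0 := by
      rw [he, RingEquiv.trans_apply, quotientEquiv_mk_u]
      change congrRight (ResidueField Λ) h0 (u _ _) = _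
      rw [u, congrRight_mk, u]
      rfl
    rw [← this]
    exact Ideal.mem_map_of_mem _ (Ideal.mem_map_of_mem _ hu)
  have hv' : v (ResidueField Λ) 0 ∈ 𝔔bar.map e.toRingHom := by
    have : e (Ideal.Quotient.mk _ (v Λ a₀)) = v (ResidueField Λ) 0 := by
      rw [he, RingEquiv.trans_apply, quotientEquiv_mk_v]
      change congrRight (ResidueField Λ) h0 (v _ _) = _
      rw [v, congrRight_mk, v]
      rfl
    rw [← this]
    exact Ideal.mem_map_of_mem _ (Ideal.mem_map_of_mem _ hv)
  rintro z (rfl | rfl)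
  · exact hu'
  · exact hv'

end ChartOrigin

/-! ## The quasi-split datum at a chart origin -/

section Main

open DeJong1996 DeJong1996.AlgebraicNodeRing

/-- **Abstract form of `exists_fibreCpl_equiv_nodeQuot_of_chart`**: the chart ring `R` enters only
through an identification `R/𝔪_Λ R ≅ κ[x, y]/(xy)` carrying the image of `𝔔` to the origin. -/
theorem exists_fibreCpl_equiv_nodeQuot_of_quotient_equiv {A Λ O' R T : Type u} [CommRing A] [IsLocalRing A]
    [CommRing Λ] [IsLocalRing Λ] [CommRing O'] [IsLocalRing O'] [IsNoetherianRing O']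
    [CommRing R] [Algebra Λ R] [CommRing T] [IsLocalRing T] [IsNoetherianRing T]
    (ψ : A →+* O') (β : A →+* Λ) (hβM : (maximalIdeal A).map β = maximalIdeal Λ)
    (hβR : Function.Surjective ((Ideal.Quotient.mk (maximalIdeal Λ)).comp β))
    (𝔔 : Ideal R) [𝔔.IsPrime] [Algebra R T] [IsLocalization.AtPrime T 𝔔] [Algebra Λ T] [IsScalarTower Λ R T]
    (h𝔔Λ : (maximalIdeal Λ).map (algebraMap Λ R) ≤ 𝔔)
    (eR : (R ⧸ (maximalIdeal Λ).map (algebraMap Λ R)) ≃+* AlgebraicNodeRing (ResidueField Λ) 0)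
    (hnode : (𝔔.map (Ideal.Quotient.mk ((maximalIdeal Λ).map (algebraMap Λ R)))).map eR.toRingHom =
      nodeOrigin (ResidueField Λ))
    (heR : ∀ l : Λ, eR (Ideal.Quotient.mk _ (algebraMap Λ R l)) =
      algebraMap (ResidueField Λ) _ (Ideal.Quotient.mk (maximalIdeal Λ) l))
    (E : LocalCpl O' ≃+* LocalCpl T)
    (hE : ∀ a, E (AdicCompletion.of _ _ (ψ a)) = AdicCompletion.of _ _ (algebraMap Λ T (β a))) :
    ∃ e : AdicCompletion ((maximalIdeal O').map (Ideal.Quotient.mk ((maximalIdeal A).map ψ)))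
        (O' ⧸ (maximalIdeal A).map ψ) ≃+*
      MvPowerSeries (Fin 2) (A ⧸ maximalIdeal A) ⧸
        Ideal.span {(MvPowerSeries.X 0 * MvPowerSeries.X 1 : MvPowerSeries (Fin 2) (A ⧸ maximalIdeal A))},
      e.toRingHom.comp ((algebraMap (O' ⧸ (maximalIdeal A).map ψ) _).comp
        (Ideal.quotientMap ((maximalIdeal A).map ψ) ψ Ideal.le_comap_map)) =
      algebraMap (A ⧸ maximalIdeal A) _ := by
  classical
  -- step 1: completed fibre rings `(𝒪'/𝔪_A 𝒪')^ ≅ (T/𝔪_A T)^`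
  obtain ⟨E₁, hE₁⟩ := exists_fibreCpl_equiv_of_localCpl_equiv ψ ((algebraMap Λ T).comp β) E hE
  -- step 2: `𝔪_A T = I T` for `I = 𝔪_Λ R`
  have hIT : (maximalIdeal A).map ((algebraMap Λ T).comp β) = (((maximalIdeal Λ).map (algebraMap Λ R)).map (algebraMap R T)) := by
    rw [← Ideal.map_map, hβM, Ideal.map_map, ← IsScalarTower.algebraMap_eq]
  -- the prime `𝔔̄` of `R/I` corresponds to the origin, hence is maximal
  haveI h𝔔barp : (𝔔.map (Ideal.Quotient.mk ((maximalIdeal Λ).map (algebraMap Λ R)))).IsPrime := isPrime_map_quotient_mk 𝔔 h𝔔Λ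
  haveI h𝔔barm : (𝔔.map (Ideal.Quotient.mk ((maximalIdeal Λ).map (algebraMap Λ R)))).IsMaximal := by
    have h1 : (𝔔.map (Ideal.Quotient.mk ((maximalIdeal Λ).map (algebraMap Λ R)))) = (nodeOrigin (ResidueField Λ)).comap eR.toRingHom := by
      rw [← hnode]
      exact (Ideal.comap_map_of_bijective eR.toRingHom eR.bijective).symm
    rw [h1]
    exact Ideal.comap_isMaximal_of_surjective (H := nodeOrigin_isMaximal (ResidueField Λ))
      eR.toRingHom eR.surjective
  -- `T/IT` is the local ring of `R/I` at `𝔔̄`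
  haveI hloc : IsLocalization.AtPrime (T ⧸ (((maximalIdeal Λ).map (algebraMap Λ R)).map (algebraMap R T))) (𝔔.map (Ideal.Quotient.mk ((maximalIdeal Λ).map (algebraMap Λ R)))) := by
    have inst : @IsLocalization (R ⧸ ((maximalIdeal Λ).map (algebraMap Λ R))) _ (Algebra.algebraMapSubmonoid (R ⧸ ((maximalIdeal Λ).map (algebraMap Λ R))) 𝔔.primeCompl)
        (T ⧸ (((maximalIdeal Λ).map (algebraMap Λ R)).map (algebraMap R T))) _ _ := inferInstance
    rwa [algebraMapSubmonoid_quotient_primeCompl 𝔔 h𝔔Λ] at inst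
  haveI : IsLocalRing (T ⧸ (((maximalIdeal Λ).map (algebraMap Λ R)).map (algebraMap R T))) := IsLocalization.AtPrime.isLocalRing (T ⧸ (((maximalIdeal Λ).map (algebraMap Λ R)).map (algebraMap R T))) (𝔔.map (Ideal.Quotient.mk ((maximalIdeal Λ).map (algebraMap Λ R))))
  -- step 3: `(T/𝔪_A T)^ ≅ (T/IT)^` (equality of ideals) `≅ (R/I)^_𝔔̄` (localization at a maximal ideal)
  let c₁ : (T ⧸ (maximalIdeal A).map ((algebraMap Λ T).comp β)) ≃+* (T ⧸ (((maximalIdeal Λ).map (algebraMap Λ R)).map (algebraMap R T))) := Ideal.quotEquivOfEq hIT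
  have hc₁I : ((maximalIdeal T).map (Ideal.Quotient.mk ((maximalIdeal A).map ((algebraMap Λ T).comp β)))).map
      c₁.toRingHom = localMaxIdeal (T ⧸ (((maximalIdeal Λ).map (algebraMap Λ R)).map (algebraMap R T))) := by
    rw [Ideal.map_map (Ideal.Quotient.mk ((maximalIdeal A).map ((algebraMap Λ T).comp β))) c₁.toRingHom]
    have hsurj : Function.Surjective (c₁.toRingHom.comp
        (Ideal.Quotient.mk ((maximalIdeal A).map ((algebraMap Λ T).comp β)))) :=
      c₁.surjective.comp Ideal.Quotient.mk_surjective
    haveI := IsLocalHom.of_surjective _ hsurj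
    exact IsLocalRing.map_maximalIdeal_of_surjective _ hsurj
  let c₂ := adicCompletionCongr _ _ c₁ hc₁I
  let c₃ := (adicCompletionEquivOfIsLocalizationAtMaximal (𝔔.map (Ideal.Quotient.mk ((maximalIdeal Λ).map (algebraMap Λ R)))) (T ⧸ (((maximalIdeal Λ).map (algebraMap Λ R)).map (algebraMap R T)))).symm
  -- step 4: `R/I ≅ κ[x, y]/(xy)` and its `(x̄, ȳ)`-adic completion `κ⟦x, y⟧/(xy)`
  let c₄ := adicCompletionCongr _ _ eR hnode
  obtain ⟨ν, hν⟩ := exists_completion_algebraicNodeRing_equiv (ResidueField Λ)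
  -- step 5: `κ = Λ/𝔪_Λ ≅ A/𝔪_A` along `β`
  have hle : maximalIdeal A ≤ (maximalIdeal Λ).comap β := by
    rw [← Ideal.map_le_iff_le_comap, hβM]
  have hbij : Function.Bijective (Ideal.quotientMap (maximalIdeal Λ) β hle) := by
    refine ⟨Ideal.quotientMap_injective' (IsLocalRing.le_maximalIdeal
      (Ideal.comap_ne_top β (IsLocalRing.maximalIdeal.isMaximal Λ).ne_top)), fun z => ?_⟩
    obtain ⟨a, ha⟩ := hβR z
    exact ⟨Ideal.Quotient.mk _ a, by rw [Ideal.quotientMap_mk]; exact ha⟩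
  let eκ : (A ⧸ maximalIdeal A) ≃+* ResidueField Λ := RingEquiv.ofBijective _ hbij
  let c₅ : (MvPowerSeries (Fin 2) (ResidueField Λ) ⧸
      Ideal.span {(MvPowerSeries.X 0 * MvPowerSeries.X 1 : MvPowerSeries (Fin 2) (ResidueField Λ))}) ≃+*
      (MvPowerSeries (Fin 2) (A ⧸ maximalIdeal A) ⧸
        Ideal.span {(MvPowerSeries.X 0 * MvPowerSeries.X 1 : MvPowerSeries (Fin 2) (A ⧸ maximalIdeal A))}) :=
    Ideal.quotientEquiv _ _ (MvPowerSeries.mapRingEquiv (σ := Fin 2) eκ.symm) (by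
      rw [Ideal.map_span, Set.image_singleton, RingHom.coe_coe, map_mul, MvPowerSeries.mapRingEquiv_X,
        MvPowerSeries.mapRingEquiv_X])
  refine ⟨E₁.trans (c₂.trans (c₃.trans (c₄.trans (ν.trans c₅)))), ?_⟩
  -- the compatibility, checked on `A`
  refine Ideal.Quotient.ringHom_ext (RingHom.ext fun a => ?_)
  have s2 : c₂ (AdicCompletion.of _ _ (Ideal.Quotient.mk _ (((algebraMap Λ T).comp β) a))) =
      AdicCompletion.of (localMaxIdeal (T ⧸ (((maximalIdeal Λ).map (algebraMap Λ R)).map (algebraMap R T)))) (T ⧸ (((maximalIdeal Λ).map (algebraMap Λ R)).map (algebraMap R T)))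
        (Ideal.Quotient.mk _ (algebraMap Λ T (β a))) := by
    rw [adicCompletionCongr_of]
    rfl
  have s3 : c₃ (AdicCompletion.of (localMaxIdeal (T ⧸ (((maximalIdeal Λ).map (algebraMap Λ R)).map (algebraMap R T)))) (T ⧸ (((maximalIdeal Λ).map (algebraMap Λ R)).map (algebraMap R T)))
      (Ideal.Quotient.mk _ (algebraMap Λ T (β a)))) =
      AdicCompletion.of (𝔔.map (Ideal.Quotient.mk ((maximalIdeal Λ).map (algebraMap Λ R)))) (R ⧸ ((maximalIdeal Λ).map (algebraMap Λ R))) (Ideal.Quotient.mk _ (algebraMap Λ R (β a))) := by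
    rw [RingEquiv.symm_apply_eq, adicCompletionEquivOfIsLocalizationAtMaximal_of,
      Ideal.Quotient.algebraMap_quotient_map_quotient, ← IsScalarTower.algebraMap_apply]
  have s4 : c₄ (AdicCompletion.of (𝔔.map (Ideal.Quotient.mk ((maximalIdeal Λ).map (algebraMap Λ R)))) (R ⧸ ((maximalIdeal Λ).map (algebraMap Λ R))) (Ideal.Quotient.mk _ (algebraMap Λ R (β a)))) =
      AdicCompletion.of _ _ (algebraMap (ResidueField Λ) (AlgebraicNodeRing (ResidueField Λ) 0)
        (Ideal.Quotient.mk (maximalIdeal Λ) (β a))) := by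
    rw [adicCompletionCongr_of, heR]
  have s5 : ∀ c : ResidueField Λ, ν (AdicCompletion.of _ _ (algebraMap (ResidueField Λ)
      (AlgebraicNodeRing (ResidueField Λ) 0) c)) = algebraMap (ResidueField Λ) _ c := fun c => by
    rw [AlgebraicNodeRing.algebraMap_eq, ← AlgebraicNodeRing.mk_apply, hν, MvPolynomial.coe_C,
      ← Ideal.Quotient.mk_algebraMap, MvPowerSeries.algebraMap_apply, Algebra.algebraMap_self, RingHom.id_apply]
  have s6 : ∀ c : ResidueField Λ, c₅ (algebraMap (ResidueField Λ) _ c) = algebraMap (A ⧸ maximalIdeal A) _ (eκ.symm c) := by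
    intro c
    rw [← Ideal.Quotient.mk_algebraMap, MvPowerSeries.algebraMap_apply, Algebra.algebraMap_self,
      RingHom.id_apply]
    change Ideal.quotientEquiv _ _ (MvPowerSeries.mapRingEquiv (σ := Fin 2) eκ.symm) _ (Ideal.Quotient.mk _ _) = _
    rw [Ideal.quotientEquiv_mk]
    change Ideal.Quotient.mk _ (MvPowerSeries.map (σ := Fin 2) eκ.symm.toRingHom (MvPowerSeries.C c)) = _
    rw [MvPowerSeries.map_C, ← Ideal.Quotient.mk_algebraMap, MvPowerSeries.algebraMap_apply,
      Algebra.algebraMap_self, RingHom.id_apply]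
    rfl
  have s7 : eκ.symm (Ideal.Quotient.mk (maximalIdeal Λ) (β a)) = Ideal.Quotient.mk (maximalIdeal A) a := by
    rw [RingEquiv.symm_apply_eq]
    change Ideal.Quotient.mk (maximalIdeal Λ) (β a) = Ideal.quotientMap (maximalIdeal Λ) β hle (Ideal.Quotient.mk _ a)
    rw [Ideal.quotientMap_mk]
  simp only [RingHom.comp_apply, Ideal.quotientMap_mk, RingEquiv.toRingHom_eq_coe, RingHom.coe_coe]
  rw [RingEquiv.trans_apply, RingEquiv.trans_apply, RingEquiv.trans_apply, RingEquiv.trans_apply,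
    RingEquiv.trans_apply]
  erw [hE₁ a]
  rw [s2, s3, s4, s5, s6, s7]

/-- **The completed fibre local ring at a chart origin is the formal node over `κ(A)`.** Let
`ψ : A → 𝒪'` (local Noetherian `𝒪'`), `β : A → Λ` a ring map of local rings with `𝔪_A Λ = 𝔪_Λ` and
`A → Λ/𝔪_Λ` onto, `R = Λ[x, y]/(xy - a₀)` a chart ring, `T` a local ring of `R` at a prime
`𝔔 ⊇ 𝔪_Λ R` containing `x̄` and `ȳ`; if `𝒪̂' ≅ T̂` compatibly with `ψ` and `(Λ → T) ∘ β`, then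
`(𝒪'/𝔪_A 𝒪')^ ≅ κ(A)⟦u, v⟧/(uv)` compatibly with the structure maps from `κ(A)` — the quasi-split
rendering of the line at the point (de Jong 1997, 5.7: "rational with rational tangents"; de Jong
1996, p. 64: the special fibre of the chart is `k[u, t₁']/(ut₁')`, singular only at the origin).
Proof: `(𝒪'/𝔪_A𝒪')^ ≅ (T/𝔪_A T)^` (`exists_fibreCpl_equiv_of_localCpl_equiv`);
`T/𝔪_Λ T = (R/𝔪_Λ R)_{𝔔̄}` with `R/𝔪_Λ R ≅ κ[x, y]/(xy)` (`quotientEquiv`, `a₀ ∈ 𝔪_Λ`) and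
`𝔔̄ = (x̄, ȳ)` maximal, so its completion is the `(x̄, ȳ)`-adic completion of `κ[x, y]/(xy)`, i.e.
`κ⟦x, y⟧/(xy)` (`exists_completion_algebraicNodeRing_equiv`); finally `κ = Λ/𝔪_Λ ≅ A/𝔪_A`.
[cite: DeJong1996, 3.4 Claim (ii), p. 64] [cite: DeJong1997, 5.7 and proof of Prop. 5.11, pp. 614, 618] -/
theorem exists_fibreCpl_equiv_nodeQuot_of_chart {A Λ O' T : Type u} [CommRing A] [IsLocalRing A]
    [CommRing Λ] [IsLocalRing Λ] [CommRing O'] [IsLocalRing O'] [IsNoetherianRing O']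
    [CommRing T] [IsLocalRing T] [IsNoetherianRing T]
    (ψ : A →+* O') (β : A →+* Λ) (hβM : (maximalIdeal A).map β = maximalIdeal Λ)
    (hβR : Function.Surjective ((Ideal.Quotient.mk (maximalIdeal Λ)).comp β))
    {a₀ : Λ} (𝔔 : Ideal (AlgebraicNodeRing Λ a₀)) [𝔔.IsPrime]
    [Algebra (AlgebraicNodeRing Λ a₀) T] [IsLocalization.AtPrime T 𝔔] [Algebra Λ T]
    [IsScalarTower Λ (AlgebraicNodeRing Λ a₀) T]
    (h𝔔Λ : (maximalIdeal Λ).map (algebraMap Λ (AlgebraicNodeRing Λ a₀)) ≤ 𝔔)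
    (hu : u Λ a₀ ∈ 𝔔) (hv : v Λ a₀ ∈ 𝔔)
    (E : LocalCpl O' ≃+* LocalCpl T)
    (hE : ∀ a, E (AdicCompletion.of _ _ (ψ a)) = AdicCompletion.of _ _ (algebraMap Λ T (β a))) :
    ∃ e : AdicCompletion ((maximalIdeal O').map (Ideal.Quotient.mk ((maximalIdeal A).map ψ)))
        (O' ⧸ (maximalIdeal A).map ψ) ≃+*
      MvPowerSeries (Fin 2) (A ⧸ maximalIdeal A) ⧸
        Ideal.span {(MvPowerSeries.X 0 * MvPowerSeries.X 1 : MvPowerSeries (Fin 2) (A ⧸ maximalIdeal A))},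
      e.toRingHom.comp ((algebraMap (O' ⧸ (maximalIdeal A).map ψ) _).comp
        (Ideal.quotientMap ((maximalIdeal A).map ψ) ψ Ideal.le_comap_map)) =
      algebraMap (A ⧸ maximalIdeal A) _ := by
  have ha₀ : a₀ ∈ maximalIdeal Λ := mem_maximalIdeal_of_v_mem 𝔔 h𝔔Λ hv
  have h0 : Ideal.Quotient.mk (maximalIdeal Λ) a₀ = 0 := Ideal.Quotient.eq_zero_iff_mem.mpr ha₀
  exact exists_fibreCpl_equiv_nodeQuot_of_quotient_equiv ψ β hβM hβR 𝔔 h𝔔Λ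
    ((quotientEquiv Λ a₀ (maximalIdeal Λ)).trans (congrRight (ResidueField Λ) h0).toRingEquiv)
    (map_quotient_eq_nodeOrigin 𝔔 h𝔔Λ hu hv h0)
    (fun l => (congrArg (congrRight (ResidueField Λ) h0)
      (quotientEquiv_mk_algebraMap Λ a₀ (maximalIdeal Λ) l)).trans (AlgEquiv.commutes _ _)) E hE

end Main

end Summit.ResolutionOfSingularities.ResolutionOfSingularities.Theorems

end
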